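import Summits.CriticalPhenomena.CardyFormulaZ2.Theorems.CardyComplexConeParafermionToSLESixFamiliesDiamondBIdChain
import HarnessLib

/-!
# Line `potential-darboux-picard-diamond`, stub S4v (`stub_boundaryIdentification`): sectors at the break points of the diamond and of the hexagon

Helper file of the stub `stub_boundaryIdentification` of crux `ParafermionToSLESixFamilies` (stmt-CriticalPhenomena-11389).
Elementary plane geometry feeding the local analysis of step (v): with `u j` the unit direction of the boundary piece
`j` of the diamond and `d j` the unit direction of the edge `j` of the limit hexagon,
* the unit directions turn by the geometric turn, `u (j+1) = u j · e^{i g_j}` (`unitDir_succ`), the edge directions by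
  `θ_j = ⅔ g_j + π/3·[mark]`, so the unit number `κ_j = d_j³ / u_j²` satisfies `κ_{j+1}² = κ_j²` (`kappa_sq_succ`): the
  boundary phase of `H² = ((G′)³ψ/ψ′)²` is the same on every piece;
* near the break point `ℓ(t (j+1))` the diamond lies in the sector `{0 < arg ((z - ℓ(t (j+1)))/u (j+1)) < π - g_j}` and
  its two adjacent closed pieces on the boundary rays of that sector (`dom_sector_at_break`, `dom_rays_at_break`);
* the interior of the hexagon lies in the sector `{0 < arg ((w - G(ℓ(t (j+1))))/d (j+1)) < π - θ_j}` at the vertex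
  `G(ℓ(t (j+1)))` and the images of the two adjacent pieces on its boundary rays (`img_sector_at_break`, registered
  helper, `img_rays_at_break`);
* along a piece, the diamond is to the left of the piece and the hexagon interior to the left of the edge
  (`im_dom_piece_pos`, `im_img_piece_pos`), the piece and its image being on the respective lines.
-/

noncomputable section

namespace Summit.CriticalPhenomena.CardyFormulaZ2.Cruxes.ParafermionToSLESixFamilies.PotentialDarbouxPicardDiamond

open scoped Topology Real ComplexConjugate
open Filter Set Metric Complex
open Literature.Probability.RandomPlanarGeometry

/-! ## Unit vectors and arguments -/

/-- For a unit complex number `u`, `conj u = u⁻¹`. -/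
theorem conj_eq_inv_of_norm_eq_one {u : ℂ} (hu : ‖u‖ = 1) : conj u = u⁻¹ := by
  have hu0 : u ≠ 0 := by rintro rfl; simp at hu
  have h : u * conj u = 1 := by rw [mul_conj, normSq_eq_norm_sq, hu]; simp
  exact (eq_inv_of_mul_eq_one_right h)

/-- The unit direction of a non-degenerate segment. -/
theorem norm_unitDir {p q : ℂ} (hpq : p ≠ q) : ‖(q - p) / (‖q - p‖ : ℂ)‖ = 1 := by
  have hL : (0:ℝ) < ‖q - p‖ := norm_pos_iff.2 (sub_ne_zero.2 hpq.symm)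
  rw [norm_div, norm_real, Real.norm_eq_abs, abs_of_pos hL, div_self hL.ne']

/-- `im ((z - p) conj (q - p)) = ‖q - p‖ · im ((z - p) / u)` for the unit direction `u` of `[p, q]`. -/
theorem im_mul_conj_eq {p q z : ℂ} (hpq : p ≠ q) :
    ((z - p) * conj (q - p)).im = ‖q - p‖ * ((z - p) / ((q - p) / (‖q - p‖ : ℂ))).im := by
  have hL : (0:ℝ) < ‖q - p‖ := norm_pos_iff.2 (sub_ne_zero.2 hpq.symm)
  have hL' : (‖q - p‖ : ℂ) ≠ 0 := by exact_mod_cast hL.ne'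
  have hqp : q - p ≠ 0 := sub_ne_zero.2 hpq.symm
  have : (z - p) / ((q - p) / (‖q - p‖ : ℂ)) = (‖q - p‖ : ℂ) * ((z - p) * conj (q - p)) / (‖q - p‖ : ℂ) ^ 2 := by
    rw [div_div_eq_mul_div]
    have h2 : (q - p) * conj (q - p) = (‖q - p‖ : ℂ) ^ 2 := by rw [mul_conj, normSq_eq_norm_sq]; push_cast; ring
    field_simp
    rw [← h2]; ring
  rw [this, show (‖q - p‖ : ℂ) * ((z - p) * conj (q - p)) / (‖q - p‖ : ℂ) ^ 2 =
    ((‖q - p‖⁻¹ : ℝ) : ℂ) * ((z - p) * conj (q - p)) by push_cast; field_simp, im_ofReal_mul]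
  field_simp

/-- **An open sector from two half-planes.** If `im w > 0` and `im (w e^{iτ}) > 0` with `0 ≤ τ < π`, then
`0 < arg w < π - τ` (for `τ < 0` the second half-plane is automatic). -/
theorem arg_mem_of_im_pos {w : ℂ} {τ : ℝ} (hw : 0 < w.im) (hτ : τ < π)
    (hwτ : 0 < (w * exp (τ * I)).im) : 0 < arg w ∧ arg w < π - τ := by
  have hw0 : w ≠ 0 := by rintro rfl; simp at hw
  have hargpos : 0 < arg w := by
    rcases (Complex.arg_nonneg_iff.2 hw.le).lt_or_eq with h | h
    · exact h
    · exfalso; have := Complex.arg_eq_zero_iff.1 h.symm; linarith [this.2]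
  have hargle : arg w ≤ π := Complex.arg_le_pi w
  refine ⟨hargpos, ?_⟩
  -- `w e^{iτ} = ‖w‖ e^{i(arg w + τ)}` has imaginary part `‖w‖ sin (arg w + τ)`
  have hpolar : w * exp (τ * I) = (‖w‖ : ℂ) * exp (((arg w + τ : ℝ) : ℂ) * I) := by
    conv_lhs => rw [← norm_mul_exp_arg_mul_I w]
    rw [mul_assoc, ← Complex.exp_add]; congr 1; push_cast; ring
  have him : (w * exp (τ * I)).im = ‖w‖ * Real.sin (arg w + τ) := by
    rw [hpolar, im_ofReal_mul, exp_ofReal_mul_I_im]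
  rw [him] at hwτ
  have hsin : 0 < Real.sin (arg w + τ) := pos_of_mul_pos_right hwτ (norm_nonneg _)
  by_contra hge
  push Not at hge
  have h1 : π ≤ arg w + τ := by linarith
  have h2 : arg w + τ < 2 * π := by linarith
  have : Real.sin (arg w + τ) ≤ 0 := by
    rw [← Real.sin_sub_two_pi]
    exact Real.sin_nonpos_of_nonpos_of_neg_pi_le (by linarith) (by linarith)
  linarith

/-- `-e^{-iτ} = e^{i(π - τ)}`. -/
theorem neg_exp_neg_mul_I (τ : ℝ) : -exp (-(τ : ℂ) * I) = exp (((π - τ : ℝ) : ℂ) * I) := by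
  rw [show ((π - τ : ℝ) : ℂ) * I = π * I + -(τ : ℂ) * I by push_cast; ring, Complex.exp_add, exp_pi_mul_I]
  ring

/-! ## The directions of the pieces and of the edges -/

/-- The edge directions are unit vectors. -/
theorem norm_dir_eq_one {d : ℕ → ℂ} {θ : ℕ → ℝ} (hd0 : ‖d 0‖ = 1) (hd : ∀ j, d (j + 1) = d j * exp (θ j * I)) :
    ∀ j, ‖d j‖ = 1 := by
  intro j
  induction j with
  | zero => exact hd0
  | succ j ih => rw [hd, norm_mul, ih, norm_exp_ofReal_mul_I, one_mul]

/-- **The unit directions of consecutive pieces turn by the geometric turn**: `u (j+1) = u j · e^{i g_j}` with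
`g_j = arg ((ℓ(t (j+2)) - ℓ(t (j+1))) / (ℓ(t (j+1)) - ℓ(t j)))`. -/
theorem unitDir_succ {ℓ : ℝ → ℂ} {t : ℕ → ℝ} (hne : ∀ j, ℓ (t j) ≠ ℓ (t (j + 1))) (j : ℕ) :
    (ℓ (t (j + 1 + 1)) - ℓ (t (j + 1))) / (‖ℓ (t (j + 1 + 1)) - ℓ (t (j + 1))‖ : ℂ) =
      (ℓ (t (j + 1)) - ℓ (t j)) / (‖ℓ (t (j + 1)) - ℓ (t j)‖ : ℂ) *
        exp ((((ℓ (t (j + 2)) - ℓ (t (j + 1))) / (ℓ (t (j + 1)) - ℓ (t j))).arg : ℂ) * I) := by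
  rw [show j + 1 + 1 = j + 2 by ring]
  set A : ℂ := ℓ (t (j + 1)) - ℓ (t j) with hA
  set B : ℂ := ℓ (t (j + 2)) - ℓ (t (j + 1)) with hB
  have hA0 : A ≠ 0 := sub_ne_zero.2 (hne j).symm
  have hB0 : B ≠ 0 := sub_ne_zero.2 (by rw [show j + 2 = j + 1 + 1 by ring]; exact (hne (j + 1)).symm)
  have hAn : (‖A‖ : ℂ) ≠ 0 := by exact_mod_cast (norm_pos_iff.2 hA0).ne'
  have hBn : (‖B‖ : ℂ) ≠ 0 := by exact_mod_cast (norm_pos_iff.2 hB0).ne'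
  set ψ : ℝ := arg (B / A) with hψ
  have hpol : B / A = (‖B / A‖ : ℂ) * exp ((ψ : ℂ) * I) := (norm_mul_exp_arg_mul_I _).symm
  rw [norm_div] at hpol
  have key : exp ((ψ : ℂ) * I) = B / A * (‖A‖ : ℂ) / (‖B‖ : ℂ) := by
    rw [hpol]; push_cast; field_simp
  rw [key]; field_simp

/-- **The boundary phase is the same on every piece**: with `u j` the unit direction of piece `j`, `d j` unit edge
directions turning by `θ_j = ⅔ g_j + π/3 · markInd`, the numbers `κ_j = d_j³ / u_j²` satisfy `κ_{j+1}² = κ_j²`. -/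
theorem kappa_sq_succ {D : DobrushinDomain} {ℓ : ℝ → ℂ} {t : ℕ → ℝ} {d : ℕ → ℂ}
    (hne : ∀ j, ℓ (t j) ≠ ℓ (t (j + 1)))
    (hd : ∀ j, d (j + 1) = d j * Complex.exp ((((2 / 3 : ℝ) * ((ℓ (t (j + 2)) - ℓ (t (j + 1))) /
      (ℓ (t (j + 1)) - ℓ (t j))).arg + Real.pi / 3 * markInd D (ℓ (t (j + 1)))) : ℝ) * Complex.I)) (j : ℕ) :
    (d (j + 1) ^ 3 / ((ℓ (t (j + 1 + 1)) - ℓ (t (j + 1))) / (‖ℓ (t (j + 1 + 1)) - ℓ (t (j + 1))‖ : ℂ)) ^ 2) ^ 2 =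
      (d j ^ 3 / ((ℓ (t (j + 1)) - ℓ (t j)) / (‖ℓ (t (j + 1)) - ℓ (t j)‖ : ℂ)) ^ 2) ^ 2 := by
  rw [unitDir_succ hne j, hd j]
  set g : ℝ := ((ℓ (t (j + 2)) - ℓ (t (j + 1))) / (ℓ (t (j + 1)) - ℓ (t j))).arg with hg
  set m : ℝ := markInd D (ℓ (t (j + 1))) with hm
  have hexp6 : exp ((((2 / 3 : ℝ) * g + π / 3 * m : ℝ) : ℂ) * I) ^ 6 = exp ((g : ℂ) * I) ^ 4 := by
    rw [← Complex.exp_nat_mul, ← Complex.exp_nat_mul]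
    have hm01 : m = 0 ∨ m = 1 := by
      simp only [hm, markInd]; split_ifs <;> simp
    rcases hm01 with h0 | h1
    · rw [h0]; congr 1; push_cast; ring
    · rw [h1]
      have : ((6:ℕ) : ℂ) * ((((2 / 3 : ℝ) * g + π / 3 * 1 : ℝ) : ℂ) * I) = (4:ℕ) * ((g : ℂ) * I) + 2 * π * I := by
        push_cast; ring
      rw [this, Complex.exp_add, Complex.exp_two_pi_mul_I, mul_one]
  have hid : ∀ (a v E F : ℂ), E ^ 6 = F ^ 4 → F ≠ 0 → ((a * E) ^ 3 / (v * F) ^ 2) ^ 2 = (a ^ 3 / v ^ 2) ^ 2 := by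
    intro a v E F hEF hF
    have : ((a * E) ^ 3 / (v * F) ^ 2) ^ 2 = (a ^ 3 / v ^ 2) ^ 2 * (E ^ 6 / F ^ 4) := by ring
    rw [this, hEF, div_self (pow_ne_zero _ hF), mul_one]
  exact hid _ _ _ _ hexp6 (exp_ne_zero _)

/-- **The squared boundary phase `κ_j²` does not depend on the piece.** -/
theorem kappa_sq_eq {D : DobrushinDomain} {ℓ : ℝ → ℂ} {t : ℕ → ℝ} {d : ℕ → ℂ}
    (hne : ∀ j, ℓ (t j) ≠ ℓ (t (j + 1)))
    (hd : ∀ j, d (j + 1) = d j * Complex.exp ((((2 / 3 : ℝ) * ((ℓ (t (j + 2)) - ℓ (t (j + 1))) /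
      (ℓ (t (j + 1)) - ℓ (t j))).arg + Real.pi / 3 * markInd D (ℓ (t (j + 1)))) : ℝ) * Complex.I)) (j : ℕ) :
    (d j ^ 3 / ((ℓ (t (j + 1)) - ℓ (t j)) / (‖ℓ (t (j + 1)) - ℓ (t j)‖ : ℂ)) ^ 2) ^ 2 =
      (d 0 ^ 3 / ((ℓ (t 1) - ℓ (t 0)) / (‖ℓ (t 1) - ℓ (t 0)‖ : ℂ)) ^ 2) ^ 2 := by
  induction j with
  | zero => rfl
  | succ j ih => rw [kappa_sq_succ hne hd j, ih]

/-! ## The diamond near a break point -/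

/-- **The diamond lies to the left of each piece**: `im ((z - ℓ(t j)) / u j) > 0` for `z ∈ D`. -/
theorem im_dom_piece_pos {D : DobrushinDomain} {ℓ : ℝ → ℂ} {t : ℕ → ℝ}
    (hseg : ∀ j, IsBdrySegment D (ℓ (t j)) (ℓ (t (j + 1)))) (j : ℕ) {z : ℂ} (hz : z ∈ D.carrier) :
    0 < ((z - ℓ (t j)) / ((ℓ (t (j + 1)) - ℓ (t j)) / (‖ℓ (t (j + 1)) - ℓ (t j)‖ : ℂ))).im := by
  have h := (hseg j).2.2.2.2 z hz
  rw [im_mul_conj_eq (hseg j).1] at h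
  exact pos_of_mul_pos_right h (norm_nonneg _)

/-- **A closed piece lies on its line**: `im ((y - ℓ(t j)) / u j) = 0` for `y ∈ [ℓ(t j), ℓ(t (j+1))]`; more
precisely `(y - ℓ(t j)) / u j = proj ≥ 0`. -/
theorem dom_piece_param {ℓ : ℝ → ℂ} {t : ℕ → ℝ} (hne : ∀ j, ℓ (t j) ≠ ℓ (t (j + 1))) (j : ℕ) {y : ℂ}
    (hy : y ∈ segment ℝ (ℓ (t j)) (ℓ (t (j + 1)))) :
    ∃ μ : ℝ, 0 ≤ μ ∧ μ ≤ ‖ℓ (t (j + 1)) - ℓ (t j)‖ ∧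
      (y - ℓ (t j)) / ((ℓ (t (j + 1)) - ℓ (t j)) / (‖ℓ (t (j + 1)) - ℓ (t j)‖ : ℂ)) = μ := by
  obtain ⟨hy', h0, h1⟩ := eq_param_of_mem_segment (hne j) hy
  refine ⟨proj (ℓ (t j)) (ℓ (t (j + 1))) y, h0, h1, ?_⟩
  have hu0 : (ℓ (t (j + 1)) - ℓ (t j)) / (‖ℓ (t (j + 1)) - ℓ (t j)‖ : ℂ) ≠ 0 := by
    intro h; have := norm_unitDir (hne j); rw [h, norm_zero] at this; exact zero_ne_one this
  rw [div_eq_iff hu0]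
  conv_lhs => rw [hy']
  ring

/-- **The sector of the diamond at a break point**: for `z ∈ D`, `w = (z - ℓ(t (j+1))) / u (j+1)` satisfies
`0 < arg w < π - g_j`, where `g_j ∈ {0, π/2}` is the geometric turn at `ℓ(t (j+1))`. -/
theorem dom_sector_at_break {D : DobrushinDomain} {ℓ : ℝ → ℂ} {t : ℕ → ℝ}
    (hseg : ∀ j, IsBdrySegment D (ℓ (t j)) (ℓ (t (j + 1))))
    (harg : ∀ j, ((ℓ (t (j + 2)) - ℓ (t (j + 1))) / (ℓ (t (j + 1)) - ℓ (t j))).arg = 0 ∨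
      ((ℓ (t (j + 2)) - ℓ (t (j + 1))) / (ℓ (t (j + 1)) - ℓ (t j))).arg = Real.pi / 2)
    (j : ℕ) {z : ℂ} (hz : z ∈ D.carrier) :
    0 < arg ((z - ℓ (t (j + 1))) / ((ℓ (t (j + 1 + 1)) - ℓ (t (j + 1))) / (‖ℓ (t (j + 1 + 1)) - ℓ (t (j + 1))‖ : ℂ))) ∧
    arg ((z - ℓ (t (j + 1))) / ((ℓ (t (j + 1 + 1)) - ℓ (t (j + 1))) / (‖ℓ (t (j + 1 + 1)) - ℓ (t (j + 1))‖ : ℂ))) <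
      π - ((ℓ (t (j + 2)) - ℓ (t (j + 1))) / (ℓ (t (j + 1)) - ℓ (t j))).arg := by
  have hne : ∀ j, ℓ (t j) ≠ ℓ (t (j + 1)) := fun j => (hseg j).1
  set g : ℝ := ((ℓ (t (j + 2)) - ℓ (t (j + 1))) / (ℓ (t (j + 1)) - ℓ (t j))).arg with hg
  set u0 : ℂ := (ℓ (t (j + 1)) - ℓ (t j)) / (‖ℓ (t (j + 1)) - ℓ (t j)‖ : ℂ) with hu0
  set u1 : ℂ := (ℓ (t (j + 1 + 1)) - ℓ (t (j + 1))) / (‖ℓ (t (j + 1 + 1)) - ℓ (t (j + 1))‖ : ℂ) with hu1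
  have hu1eq : u1 = u0 * exp ((g : ℂ) * I) := unitDir_succ hne j
  have hg0 : 0 ≤ g ∧ g < π := by
    rcases harg j with h | h
    · rw [hg, h]; exact ⟨le_rfl, Real.pi_pos⟩
    · rw [hg, h]; constructor <;> linarith [Real.pi_pos]
  have h1 : 0 < ((z - ℓ (t (j + 1))) / u1).im := im_dom_piece_pos hseg (j + 1) hz
  have h0 : 0 < ((z - ℓ (t j)) / u0).im := im_dom_piece_pos hseg j hz
  -- `(z - ℓ(t (j+1))) / u0 = (z - ℓ(t j)) / u0 - ‖Δ_j‖`
  have hu0ne : u0 ≠ 0 := by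
    intro h; have := norm_unitDir (hne j); rw [← hu0, h, norm_zero] at this; exact zero_ne_one this
  have hΔ : (ℓ (t (j + 1)) - ℓ (t j)) / u0 = (‖ℓ (t (j + 1)) - ℓ (t j)‖ : ℂ) := by
    rw [hu0, div_div_eq_mul_div, mul_comm, mul_div_assoc, div_self (sub_ne_zero.2 (hne j).symm), mul_one]
  have hshift : (z - ℓ (t (j + 1))) / u0 = (z - ℓ (t j)) / u0 - (‖ℓ (t (j + 1)) - ℓ (t j)‖ : ℂ) := by
    rw [show z - ℓ (t (j + 1)) = (z - ℓ (t j)) - (ℓ (t (j + 1)) - ℓ (t j)) by ring, sub_div, hΔ]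
  have h0' : 0 < ((z - ℓ (t (j + 1))) / u0).im := by rw [hshift, sub_im, ofReal_im, sub_zero]; exact h0
  have hrot : (z - ℓ (t (j + 1))) / u0 = (z - ℓ (t (j + 1))) / u1 * exp ((g : ℂ) * I) := by
    rw [hu1eq]; field_simp
  rw [hrot] at h0'
  exact arg_mem_of_im_pos h1 hg0.2 h0'

/-- **The two pieces adjacent to a break point lie on the boundary rays of the sector**: for
`y ∈ [ℓ(t j), ℓ(t (j+1))] ∪ [ℓ(t (j+1)), ℓ(t (j+2))]`, `(y - ℓ(t (j+1))) / u (j+1)` is `μ` or `μ e^{i(π - g_j)}` with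
`μ ≥ 0`. -/
theorem dom_rays_at_break {ℓ : ℝ → ℂ} {t : ℕ → ℝ} (hne : ∀ j, ℓ (t j) ≠ ℓ (t (j + 1))) (j : ℕ) {y : ℂ}
    (hy : y ∈ segment ℝ (ℓ (t j)) (ℓ (t (j + 1))) ∨ y ∈ segment ℝ (ℓ (t (j + 1))) (ℓ (t (j + 1 + 1)))) :
    ∃ μ : ℝ, 0 ≤ μ ∧
      ((y - ℓ (t (j + 1))) / ((ℓ (t (j + 1 + 1)) - ℓ (t (j + 1))) / (‖ℓ (t (j + 1 + 1)) - ℓ (t (j + 1))‖ : ℂ)) = μ ∨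
       (y - ℓ (t (j + 1))) / ((ℓ (t (j + 1 + 1)) - ℓ (t (j + 1))) / (‖ℓ (t (j + 1 + 1)) - ℓ (t (j + 1))‖ : ℂ)) =
         μ * exp (((π - ((ℓ (t (j + 2)) - ℓ (t (j + 1))) / (ℓ (t (j + 1)) - ℓ (t j))).arg : ℝ) : ℂ) * I)) := by
  set g : ℝ := ((ℓ (t (j + 2)) - ℓ (t (j + 1))) / (ℓ (t (j + 1)) - ℓ (t j))).arg with hg
  set u0 : ℂ := (ℓ (t (j + 1)) - ℓ (t j)) / (‖ℓ (t (j + 1)) - ℓ (t j)‖ : ℂ) with hu0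
  set u1 : ℂ := (ℓ (t (j + 1 + 1)) - ℓ (t (j + 1))) / (‖ℓ (t (j + 1 + 1)) - ℓ (t (j + 1))‖ : ℂ) with hu1
  have hu1eq : u1 = u0 * exp ((g : ℂ) * I) := unitDir_succ hne j
  have hu0ne : u0 ≠ 0 := by
    intro h; have := norm_unitDir (hne j); rw [← hu0, h, norm_zero] at this; exact zero_ne_one this
  rcases hy with hy | hy
  · -- incoming piece: `y - ℓ(t (j+1)) = -(L - μ₀) u0`
    obtain ⟨μ₀, h0, h1, hμ₀⟩ := dom_piece_param hne j hy
    set L : ℝ := ‖ℓ (t (j + 1)) - ℓ (t j)‖ with hL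
    have hLc : (L : ℂ) ≠ 0 := by exact_mod_cast (norm_pos_iff.2 (sub_ne_zero.2 (hne j).symm)).ne'
    refine ⟨L - μ₀, by linarith, Or.inr ?_⟩
    have hy1 : y - ℓ (t (j + 1)) = -((L - μ₀ : ℝ) : ℂ) * u0 := by
      have e1 : y - ℓ (t j) = (μ₀ : ℂ) * u0 := by rw [← hμ₀, div_mul_cancel₀ _ hu0ne]
      have e2 : ℓ (t (j + 1)) - ℓ (t j) = (L : ℂ) * u0 := by rw [hu0, mul_div_cancel₀ _ hLc]
      have : y - ℓ (t (j + 1)) = (y - ℓ (t j)) - (ℓ (t (j + 1)) - ℓ (t j)) := by ring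
      rw [this, e1, e2]; push_cast; ring
    have hE : exp ((g : ℂ) * I) ≠ 0 := exp_ne_zero _
    rw [hy1, hu1eq, ← neg_exp_neg_mul_I, show -(g : ℂ) * I = -((g : ℂ) * I) by ring, Complex.exp_neg]
    field_simp
  · obtain ⟨μ, h0, -, hμ⟩ := dom_piece_param hne (j + 1) hy
    exact ⟨μ, h0, Or.inl hμ⟩

/-! ## The hexagon near a vertex -/

/-- **The interior of the hexagon lies to the left of each edge line through the END of the edge as well.** -/
theorem im_img_left_of_next {ℓ : ℝ → ℂ} {t : ℕ → ℝ} {G : ℂ → ℂ} {d : ℕ → ℂ} {K : Set ℂ}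
    (htlt : ∀ j, t j < t (j + 1))
    (hmono : ∀ (j : ℕ) (s s' : ℝ), t j ≤ s → s ≤ s' → s' ≤ t (j + 1) → ∃ r : ℝ, 0 ≤ r ∧ G (ℓ s') - G (ℓ s) = r * d j)
    (hstrict : ∀ w₀ ∈ interior K, ∀ j : ℕ, 0 < ((w₀ - G (ℓ (t j))) * conj (d j)).im)
    (j : ℕ) {w₀ : ℂ} (hw₀ : w₀ ∈ interior K) : 0 < ((w₀ - G (ℓ (t (j + 1)))) * conj (d j)).im := by
  obtain ⟨r, -, hr⟩ := hmono j (t j) (t (j + 1)) le_rfl (htlt j).le le_rfl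
  have : w₀ - G (ℓ (t (j + 1))) = (w₀ - G (ℓ (t j))) - r * d j := by rw [← hr]; ring
  rw [this, sub_mul, sub_im, mul_assoc, mul_conj, normSq_eq_norm_sq]
  have h2 : ((r : ℂ) * ((‖d j‖ ^ 2 : ℝ) : ℂ)).im = 0 := by rw [← ofReal_mul, ofReal_im]
  rw [h2, sub_zero]
  exact hstrict w₀ hw₀ j

/-- **The interior of the hexagon lies to the left of each edge**: `im ((w₀ - G(ℓ(t j))) / d j) > 0`. -/
theorem im_img_piece_pos {ℓ : ℝ → ℂ} {t : ℕ → ℝ} {G : ℂ → ℂ} {d : ℕ → ℂ} {K : Set ℂ}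
    (hd1 : ∀ j, ‖d j‖ = 1) (hstrict : ∀ w₀ ∈ interior K, ∀ j : ℕ, 0 < ((w₀ - G (ℓ (t j))) * conj (d j)).im)
    (j : ℕ) {w₀ : ℂ} (hw₀ : w₀ ∈ interior K) : 0 < ((w₀ - G (ℓ (t j))) / d j).im := by
  have := hstrict w₀ hw₀ j
  rwa [conj_eq_inv_of_norm_eq_one (hd1 j), ← div_eq_mul_inv] at this

/-- **The sector of the hexagon at a vertex** (registered helper): every interior point `w₀` of the limit polygon
satisfies `0 < arg ((w₀ - G(ℓ(t (j+1)))) / d (j+1)) < π - θ_j`, where `d (j+1) = d j e^{iθ_j}`, `0 < θ_j < π`. -/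
theorem img_sector_at_break : ∀ (ℓ : ℝ → ℂ) (t : ℕ → ℝ) (G : ℂ → ℂ) (d : ℕ → ℂ) (θ : ℕ → ℝ) (K : Set ℂ), (∀ j, t j < t (j + 1)) → ‖d 0‖ = 1 → (∀ j, d (j + 1) = d j * Complex.exp (θ j * Complex.I)) → (∀ j, 0 < θ j ∧ θ j < Real.pi) → (∀ (j : ℕ) (s s' : ℝ), t j ≤ s → s ≤ s' → s' ≤ t (j + 1) → ∃ r : ℝ, 0 ≤ r ∧ G (ℓ s') - G (ℓ s) = r * d j) → (∀ w₀ ∈ interior K, ∀ j : ℕ, 0 < ((w₀ - G (ℓ (t j))) * (starRingEnd ℂ) (d j)).im) → ∀ (j : ℕ), ∀ w₀ ∈ interior K, 0 < Complex.arg ((w₀ - G (ℓ (t (j + 1)))) / d (j + 1)) ∧ Complex.arg ((w₀ - G (ℓ (t (j + 1)))) / d (j + 1)) < Real.pi - θ j := by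
  intro ℓ t G d θ K htlt hd0 hd hθ hmono hstrict j w₀ hw₀
  have hd1 := norm_dir_eq_one hd0 hd
  have h1 : 0 < ((w₀ - G (ℓ (t (j + 1)))) / d (j + 1)).im := im_img_piece_pos hd1 hstrict (j + 1) hw₀
  have h0 : 0 < ((w₀ - G (ℓ (t (j + 1)))) / d j).im := by
    have := im_img_left_of_next htlt hmono hstrict j hw₀
    rwa [conj_eq_inv_of_norm_eq_one (hd1 j), ← div_eq_mul_inv] at this
  have hdj : d j ≠ 0 := fun h => by have := hd1 j; rw [h, norm_zero] at this; exact zero_ne_one this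
  have hrot : (w₀ - G (ℓ (t (j + 1)))) / d j = (w₀ - G (ℓ (t (j + 1)))) / d (j + 1) * exp ((θ j : ℂ) * I) := by
    rw [hd j]; field_simp
  rw [hrot] at h0
  exact arg_mem_of_im_pos h1 (hθ j).2 h0

/-- **The images of the two pieces adjacent to a break point lie on the boundary rays of the vertex sector**: for
`y ∈ [ℓ(t j), ℓ(t (j+1))] ∪ [ℓ(t (j+1)), ℓ(t (j+2))]`, `(G y - G(ℓ(t (j+1)))) / d (j+1)` is `μ` or `μ e^{i(π - θ_j)}`
with `μ ≥ 0`. -/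
theorem img_rays_at_break {ℓ : ℝ → ℂ} {t : ℕ → ℝ} {G : ℂ → ℂ} {d : ℕ → ℂ} {θ : ℕ → ℝ}
    (htlt : ∀ j, t j < t (j + 1))
    (haff : ∀ (j : ℕ) (s : ℝ), t j ≤ s → s ≤ t (j + 1) →
      ℓ s = ℓ (t j) + (((s - t j) / (t (j + 1) - t j) : ℝ) : ℂ) * (ℓ (t (j + 1)) - ℓ (t j)))
    (hd1 : ∀ j, ‖d j‖ = 1) (hd : ∀ j, d (j + 1) = d j * exp (θ j * I))
    (hmono : ∀ (j : ℕ) (s s' : ℝ), t j ≤ s → s ≤ s' → s' ≤ t (j + 1) → ∃ r : ℝ, 0 ≤ r ∧ G (ℓ s') - G (ℓ s) = r * d j)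
    (j : ℕ) {y : ℂ} (hy : y ∈ segment ℝ (ℓ (t j)) (ℓ (t (j + 1))) ∨ y ∈ segment ℝ (ℓ (t (j + 1))) (ℓ (t (j + 1 + 1)))) :
    ∃ μ : ℝ, 0 ≤ μ ∧ ((G y - G (ℓ (t (j + 1)))) / d (j + 1) = μ ∨
      (G y - G (ℓ (t (j + 1)))) / d (j + 1) = μ * exp (((π - θ j : ℝ) : ℂ) * I)) := by
  have hdj : ∀ j, d j ≠ 0 := fun j h => by have := hd1 j; rw [h, norm_zero] at this; exact zero_ne_one this
  rcases hy with hy | hy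
  · obtain ⟨s, h1, h2, rfl⟩ := exists_param_of_mem_segment htlt haff hy
    obtain ⟨r, hr0, hr⟩ := hmono j s (t (j + 1)) h1 h2 le_rfl
    refine ⟨r, hr0, Or.inr ?_⟩
    have : G (ℓ s) - G (ℓ (t (j + 1))) = -((r : ℂ) * d j) := by rw [← hr]; ring
    have hE : exp ((θ j : ℂ) * I) ≠ 0 := exp_ne_zero _
    have hdj' := hdj j
    rw [this, hd j, ← neg_exp_neg_mul_I, show -(θ j : ℂ) * I = -((θ j : ℂ) * I) by ring, Complex.exp_neg]
    field_simp
  · obtain ⟨s, h1, h2, rfl⟩ := exists_param_of_mem_segment htlt haff hy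
    obtain ⟨r, hr0, hr⟩ := hmono (j + 1) (t (j + 1)) s le_rfl h1 h2
    exact ⟨r, hr0, Or.inl (by rw [hr, mul_div_assoc, div_self (hdj _), mul_one])⟩

/-- **The image of a closed piece lies on its edge line**: `(G y - G(ℓ(t j))) / d j = r ≥ 0` for
`y ∈ [ℓ(t j), ℓ(t (j+1))]`. -/
theorem img_piece_param {ℓ : ℝ → ℂ} {t : ℕ → ℝ} {G : ℂ → ℂ} {d : ℕ → ℂ}
    (htlt : ∀ j, t j < t (j + 1))
    (haff : ∀ (j : ℕ) (s : ℝ), t j ≤ s → s ≤ t (j + 1) →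
      ℓ s = ℓ (t j) + (((s - t j) / (t (j + 1) - t j) : ℝ) : ℂ) * (ℓ (t (j + 1)) - ℓ (t j)))
    (hd1 : ∀ j, ‖d j‖ = 1)
    (hmono : ∀ (j : ℕ) (s s' : ℝ), t j ≤ s → s ≤ s' → s' ≤ t (j + 1) → ∃ r : ℝ, 0 ≤ r ∧ G (ℓ s') - G (ℓ s) = r * d j)
    (j : ℕ) {y : ℂ} (hy : y ∈ segment ℝ (ℓ (t j)) (ℓ (t (j + 1)))) :
    ∃ r : ℝ, 0 ≤ r ∧ (G y - G (ℓ (t j))) / d j = r := by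
  have hdj : d j ≠ 0 := fun h => by have := hd1 j; rw [h, norm_zero] at this; exact zero_ne_one this
  obtain ⟨s, h1, h2, rfl⟩ := exists_param_of_mem_segment htlt haff hy
  obtain ⟨r, hr0, hr⟩ := hmono j (t j) s le_rfl h1 h2
  exact ⟨r, hr0, by rw [hr, mul_div_assoc, div_self hdj, mul_one]⟩

end Summit.CriticalPhenomena.CardyFormulaZ2.Cruxes.ParafermionToSLESixFamilies.PotentialDarbouxPicardDiamond

end
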